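import Literature.Computability.FineGrained.KOVFromSETH
import Literature.Computability.FineGrained.OVFromSETHSplitInstance
import HarnessLib

/-!
# SETH ⇒ `k`-OV: the `k`-Orthogonal-Vectors instance of a CNF (the `k`-way split-and-list)

The machine-free core of the `k`-list form of R. Williams' split-and-list reduction
(V. Vassilevska Williams, *On some fine-grained questions in algorithms and complexity*,
Proc. ICM 2018, §3, proof of Thm. 3.1: "Let `F` be a CNF formula with `n` variables and `m`
clauses. Split the variables into `k` parts `V_1, …, V_k` on `n/k` variables each. For every
`j = 1, …, k` and each of the `N = 2^{n/k}` partial assignments `φ` of `V_j` create a vector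
`a_j(φ) ∈ {0,1}^m` with `a_j(φ)[c] = 0` iff `φ` satisfies clause `c`; then `a_1(φ_1), …, a_k(φ_k)`
have coordinatewise product `0` iff `φ_1 ⋯ φ_k` satisfies every clause"; the case `k = 2` is
R. Williams, TCS 348 (2005), §5.1, Thm. 5.1, formalised in `…FineGrained.SplitAndListOV`), in the
conventions of the named fact `sparseKSATInRAMTime_of_kOV_inTimeO` of `…FineGrained.KOVFromSETH`:

* `KOVRed.glen n k = ⌊n/k⌋ + 1`, the common size `g` of the `k` groups of consecutive variables
  `x_{l g}, …, x_{l g + g - 1}` (`l < k`; all `n < k g` variables are covered, `N = 2^g ≥ 2`);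
* `KOVRed.satG φ g l a j`: the partial assignment `a < 2^g` of group `l` (bit `i` of `a` is the
  value of `x_{l g + i}`) already satisfies clause `j` of `φ` — some literal `(v, b)` of the clause
  has `v / g = l` and `a.testBit (v % g) = b`;
* `KOVRed.vecBit φ g l a j = [j < m] ∧ ¬ satG φ g l a j`: coordinate `j` of the vector of `(l, a)`
  (padding coordinates `j ≥ m` are `0`);
* `KOVRed.splitKOV φ k c : KOVInstance k`, `N = 2^g` vectors per list, dimension `d = c g`
  (`= c ⌊log₂ N⌋`, so the instance lies in `kOVWithDim k c`: `splitKOV_mem`, `splitInst`);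
* **`KOVRed.hasOrthogonalTuple_splitKOV_iff`**: for `0 < k` and `m ≤ c g`, `splitKOV φ k c` has
  an orthogonal `k`-tuple iff `φ` is satisfiable;
* the word encoding of a `k`-OV instance (`KOVInstance.encode`): length `2 + k N d`, the header
  `N, d`, the bit of `(l, i, j)` at position `2 + ((l N + i) d + j)`, the input width
  `Nat.size (2 + k N d)` (for `k, d ≥ 1`), and the size, width, encoding and accepted output of
  `splitInst φ k c` as an instance of `kOVWithDim k c`.

## References

* V. Vassilevska Williams, *On some fine-grained questions in algorithms and complexity*,
  Proc. ICM 2018, Vol. 4, 3447–3487, §3, Thm. 3.1 and its proof.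
* R. Williams, *A new algorithm for optimal 2-constraint satisfaction and its implications*,
  Theoret. Comput. Sci. 348 (2005) 357–365, §5.1, Thm. 5.1 (`k = 2`).
* K. Bringmann, *Fine-Grained Complexity Theory (Tutorial)*, STACS 2019, LIPIcs 126, §4, Thm. 2
  (the same construction for `k = 2`, with the time accounting `O(N D)` for the build).
-/

namespace Literature.Computability.FineGrained

open Cryptography Cryptography.WordRAM Complexity

namespace KOVRed

/-! ### The groups of variables -/

/-- The group size `g = ⌊n/k⌋ + 1`: the variables are split into the `k` groups
`x_{l g}, …, x_{l g + g - 1}`, `l < k` (print: "`k` parts on `n/k` variables each"; the `+ 1`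
covers all `n` variables when `k ∤ n` and makes `N = 2^g ≥ 2`).
[cite: VassilevskaWilliamsICM2018, §3 Thm. 3.1 (proof)] -/
def glen (n k : ℕ) : ℕ := n / k + 1

/-- `1 ≤ g`. [folklore] -/
theorem one_le_glen (n k : ℕ) : 1 ≤ glen n k := Nat.succ_pos _

/-- All `n` variables lie in the `k` groups: `n < k g`. [folklore] -/
theorem lt_mul_glen (n : ℕ) {k : ℕ} (hk : 0 < k) : n < k * glen n k := by
  unfold glen
  rw [Nat.mul_add, Nat.mul_one, Nat.mul_comm]
  exact Nat.lt_div_mul_add hk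

/-- `g ≤ n + 1`. [folklore] -/
theorem glen_le (n k : ℕ) : glen n k ≤ n + 1 := by
  unfold glen; exact Nat.succ_le_succ (Nat.div_le_self _ _)

/-! ### Satisfaction of a clause by the partial assignment of one group -/

/-- `satG φ g l a j`: clause `j` of `φ` (the empty clause past the end) has a literal `(v, b)` on a
variable of group `l` (`v / g = l`) made true by the partial assignment `a` of that group
(`x_v ↦` bit `v % g = v - l g` of `a`). (Print: "`φ` satisfies clause `c`".)
[cite: VassilevskaWilliamsICM2018, §3 Thm. 3.1 (proof)] -/
def satG (φ : CNF ℕ) (g l a j : ℕ) : Bool :=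
  (φ.getD j []).any fun lit => decide (lit.1 / g = l) && (a.testBit (lit.1 % g) == lit.2)

/-- Unfolding `satG`. [folklore] -/
theorem satG_eq_true_iff (φ : CNF ℕ) (g l a j : ℕ) :
    satG φ g l a j = true ↔ ∃ lit ∈ φ.getD j [], lit.1 / g = l ∧ a.testBit (lit.1 % g) = lit.2 := by
  simp [satG, List.any_eq_true]

/-- Past the last clause nothing is satisfied. [folklore] -/
theorem satG_of_le {φ : CNF ℕ} {j : ℕ} (hj : φ.length ≤ j) (g l a : ℕ) : satG φ g l a j = false := by
  unfold satG; rw [List.getD_eq_default _ _ hj]; rfl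

/-- **Coordinate `j` of the vector of the partial assignment `a` of group `l`**: `1` iff `j` is a
clause index and `a` does not already satisfy clause `j` (print: "`a_j(φ)[c] = 0` iff `φ`
satisfies clause `c`"; the padding coordinates `j ≥ m` are `0`).
[cite: VassilevskaWilliamsICM2018, §3 Thm. 3.1 (proof)] -/
def vecBit (φ : CNF ℕ) (g l a j : ℕ) : Bool := decide (j < φ.length) && !satG φ g l a j

/-- Padding coordinates are `0`. [folklore] -/
theorem vecBit_of_le {φ : CNF ℕ} {j : ℕ} (hj : φ.length ≤ j) (g l a : ℕ) : vecBit φ g l a j = false := by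
  simp [vecBit, Nat.not_lt.2 hj]

/-- Clause coordinates carry the negated satisfaction bit. [folklore] -/
theorem vecBit_of_lt {φ : CNF ℕ} {j : ℕ} (hj : j < φ.length) (g l a : ℕ) :
    vecBit φ g l a j = !satG φ g l a j := by
  simp [vecBit, hj]

/-! ### The `k`-OV instance -/

/-- **The `k`-way split-and-list instance of a CNF** (VVW ICM 2018, proof of Thm. 3.1): `k` lists
of `N = 2^g` vectors (`g = ⌊n/k⌋ + 1`, `n = numVars φ`) of dimension `d = c g`, the vector of the
partial assignment `a` of group `l` having coordinate `j` equal to `vecBit φ g l a j`.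
[cite: VassilevskaWilliamsICM2018, §3 Thm. 3.1 (proof)] -/
def splitKOV (φ : CNF ℕ) (k c : ℕ) : KOVInstance k where
  n := 2 ^ glen φ.numVars k
  d := c * glen φ.numVars k
  vecs l a j := vecBit φ (glen φ.numVars k) l a j

/-- The number of vectors per list is `N = 2^g`. [folklore] -/
@[simp] theorem splitKOV_n (φ : CNF ℕ) (k c : ℕ) : (splitKOV φ k c).n = 2 ^ glen φ.numVars k := rfl

/-- The dimension is `d = c g`. [folklore] -/
@[simp] theorem splitKOV_d (φ : CNF ℕ) (k c : ℕ) : (splitKOV φ k c).d = c * glen φ.numVars k := rfl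

/-- The vectors. [folklore] -/
@[simp] theorem splitKOV_vecs (φ : CNF ℕ) (k c : ℕ) (l : Fin k) (a : Fin (splitKOV φ k c).n)
    (j : Fin (splitKOV φ k c).d) :
    (splitKOV φ k c).vecs l a j = vecBit φ (glen φ.numVars k) l a j := rfl

/-- `2 ≤ N`. [folklore] -/
theorem two_le_splitKOV_n (φ : CNF ℕ) (k c : ℕ) : 2 ≤ (splitKOV φ k c).n := by
  rw [splitKOV_n]
  calc 2 = 2 ^ 1 := rfl
    _ ≤ 2 ^ glen φ.numVars k := Nat.pow_le_pow_right (by norm_num) (one_le_glen _ _)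

/-- The instance lies in the regime `d = c ⌊log₂ N⌋` of `kOVWithDim k c`. [folklore] -/
theorem splitKOV_mem (φ : CNF ℕ) (k c : ℕ) :
    splitKOV φ k c ∈ {I : KOVInstance k | I.d = c * Nat.log 2 I.n} := by
  show c * glen φ.numVars k = c * Nat.log 2 (2 ^ glen φ.numVars k)
  rw [Nat.log_pow (by norm_num)]

/-- The split-and-list instance as an instance of `kOVWithDim k c`. [folklore] -/
def splitInst (φ : CNF ℕ) (k c : ℕ) : (kOVWithDim k c).Inst := ⟨splitKOV φ k c, splitKOV_mem φ k c⟩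

/-- **The split-and-list correspondence, `k` lists** (VVW ICM 2018, proof of Thm. 3.1:
"`a_1(φ_1), …, a_k(φ_k)` have coordinatewise product `0` iff `φ_1 ⋯ φ_k` satisfies every
clause"). For `0 < k` and `m ≤ d = c g`, `splitKOV φ k c` has an orthogonal `k`-tuple iff `φ` is
satisfiable: a tuple `(a_l)_l` is orthogonal iff every clause `j < m` is satisfied by some `a_l` on
its own group iff the glued assignment `x_v ↦ a_{v / g}.testBit (v % g)` satisfies `φ`; conversely
a satisfying assignment restricts to the `k` groups (every variable is `< n < k g`).
[cite: VassilevskaWilliamsICM2018, §3 Thm. 3.1 (proof)] -/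
theorem hasOrthogonalTuple_splitKOV_iff {φ : CNF ℕ} {k c : ℕ} (hk : 0 < k)
    (hm : φ.length ≤ c * glen φ.numVars k) :
    (splitKOV φ k c).HasOrthogonalTuple ↔ φ.Satisfiable := by
  set g := glen φ.numVars k with hg
  have hg1 : 1 ≤ g := one_le_glen _ _
  constructor
  · rintro ⟨ch, hch⟩
    -- the glued assignment
    refine ⟨fun v => if h : v / g < k then ((ch ⟨v / g, h⟩ : Fin _) : ℕ).testBit (v % g) else false,
      ?_⟩
    rw [CNF.eval_eq_true_iff]
    intro cl hcl
    obtain ⟨j, hj, rfl⟩ := List.getElem_of_mem hcl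
    have hjd : j < (splitKOV φ k c).d := lt_of_lt_of_le hj hm
    obtain ⟨l, hl⟩ := hch ⟨j, hjd⟩
    rw [splitKOV_vecs, Fin.val_mk, vecBit_of_lt hj, Bool.not_eq_false'] at hl
    obtain ⟨lit, hlit, hgrp, hbit⟩ := (satG_eq_true_iff _ _ _ _ _).1 hl
    rw [List.getD_eq_getElem _ _ hj] at hlit
    unfold Clause.eval
    rw [List.any_eq_true]
    refine ⟨lit, hlit, ?_⟩
    have hlk : lit.1 / g < k := by rw [hgrp]; exact l.2
    show ((if h : lit.1 / g < k then ((ch ⟨lit.1 / g, h⟩ : Fin _) : ℕ).testBit (lit.1 % g)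
      else false) == lit.2) = true
    rw [dif_pos hlk]
    have : (⟨lit.1 / g, hlk⟩ : Fin k) = l := Fin.ext hgrp
    rw [this, hbit]
    exact beq_self_eq_true _
  · rintro ⟨σ, hσ⟩
    rw [CNF.eval_eq_true_iff] at hσ
    -- restrict `σ` to the groups
    have hN : ∀ l : ℕ, (Nat.ofBits fun i : Fin g => σ (l * g + i)) < (splitKOV φ k c).n := fun l => by
      rw [splitKOV_n]; exact Nat.ofBits_lt_two_pow _
    refine ⟨fun l => ⟨_, hN l⟩, fun t => ?_⟩
    by_cases ht : (t : ℕ) < φ.length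
    · -- a clause coordinate: the clause is satisfied by `σ`, through a literal of some group
      have hc := hσ _ (List.getElem_mem ht)
      unfold Clause.eval at hc
      obtain ⟨lit, hlit, hev⟩ := List.any_eq_true.1 hc
      have hval : σ lit.1 = lit.2 := by simpa [Literal.eval] using hev
      have hvar : lit.1 < φ.numVars := CliqueRed.lt_numVars_of_mem (List.getElem_mem ht) hlit
      have hlk : lit.1 / g < k :=
        Nat.div_lt_of_lt_mul (by rw [Nat.mul_comm]; exact hvar.trans (lt_mul_glen _ hk))
      refine ⟨⟨lit.1 / g, hlk⟩, ?_⟩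
      rw [splitKOV_vecs, vecBit_of_lt ht, Bool.not_eq_false', satG_eq_true_iff]
      refine ⟨lit, by rw [List.getD_eq_getElem _ _ ht]; exact hlit, rfl, ?_⟩
      show (Nat.ofBits fun i : Fin g => σ (lit.1 / g * g + i)).testBit (lit.1 % g) = lit.2
      rw [Nat.testBit_ofBits_lt _ _ (Nat.mod_lt _ hg1)]
      simp only
      rw [Nat.div_add_mod']
      exact hval
    · exact ⟨⟨0, hk⟩, by rw [splitKOV_vecs, vecBit_of_le (not_lt.1 ht)]⟩

end KOVRed

/-! ### The `kOV` encoding of an instance -/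

/-- The `kOV k` input of an instance: `n :: d ::` the `k` tables, each the `n` rows of `d` bits.
[folklore] -/
theorem KOV_encode_eq {k : ℕ} (I : KOVInstance k) :
    KOVInstance.encode I = I.n :: I.d :: (List.finRange k).flatMap fun l =>
      (List.finRange I.n).flatMap fun i => encodeBoolVec (I.vecs l i) := rfl

/-- `k` tables of `N` encoded vectors of dimension `d` have `k (N d)` words. [folklore] -/
theorem length_flatMap_flatMap_encodeBoolVec {k N d : ℕ} (F : Fin k → Fin N → Fin d → Bool) :
    ((List.finRange k).flatMap fun l => (List.finRange N).flatMap fun i =>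
      encodeBoolVec (F l i)).length = k * (N * d) := by
  rw [List.length_flatMap]
  have : (List.map (fun l => ((List.finRange N).flatMap fun i => encodeBoolVec (F l i)).length)
      (List.finRange k)) = List.map (fun _ => N * d) (List.finRange k) := by
    apply List.map_congr_left
    intro l _
    exact length_flatMap_encodeBoolVec _
  rw [this, List.map_const', List.sum_replicate, List.length_finRange, smul_eq_mul]

/-- **The length of a `kOV k` input**: `2 + k N d`. [folklore] -/
theorem length_KOV_encode {k : ℕ} (I : KOVInstance k) :
    (KOVInstance.encode I).length = 2 + k * (I.n * I.d) := by
  rw [KOV_encode_eq, List.length_cons, List.length_cons, length_flatMap_flatMap_encodeBoolVec]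
  ring

/-- Word `0` of a `kOV k` input is `N`. [folklore] -/
theorem KOV_encode_getElem?_zero {k : ℕ} (I : KOVInstance k) : (KOVInstance.encode I)[0]? = some I.n :=
  rfl

/-- Word `1` of a `kOV k` input is `d`. [folklore] -/
theorem KOV_encode_getElem?_one {k : ℕ} (I : KOVInstance k) : (KOVInstance.encode I)[1]? = some I.d :=
  rfl

/-- Word `2 + ((l N + i) d + j)` of a `kOV k` input is the bit `vecs l i j`. [folklore] -/
theorem KOV_encode_getElem?_vec {k : ℕ} (I : KOVInstance k) (l : Fin k) (i : Fin I.n) (j : Fin I.d) :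
    (KOVInstance.encode I)[2 + ((((l : ℕ) * I.n + i) * I.d) + j)]? = some (I.vecs l i j).toNat := by
  have hlt : (i : ℕ) * I.d + j < I.n * I.d :=
    calc (i : ℕ) * I.d + j < i * I.d + I.d := by omega
      _ = (i + 1) * I.d := by ring
      _ ≤ I.n * I.d := Nat.mul_le_mul_right _ i.2
  have h1 : 2 + (((l : ℕ) * I.n + i) * I.d + j) = ((l : ℕ) * (I.n * I.d) + (i * I.d + j)) + 1 + 1 := by
    ring
  rw [KOV_encode_eq, h1, List.getElem?_cons_succ, List.getElem?_cons_succ,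
    getElem?_flatMap_const _ (List.finRange k) (fun l _ => length_flatMap_encodeBoolVec _) l
      (by simp) _ hlt]
  simp only [List.getElem_finRange]
  rw [getElem?_flatMap_const _ (List.finRange I.n) (fun i _ => length_encodeBoolVec _) i (by simp)
    j j.2]
  simp only [List.getElem_finRange]
  exact encodeBoolVec_getElem? _ j

/-- Every word of a `kOV k` input is `N`, `d` or a bit. [folklore] -/
theorem le_of_mem_KOV_encode {k : ℕ} (I : KOVInstance k) {a : ℕ} (ha : a ∈ KOVInstance.encode I) :
    a ≤ max I.n (max I.d 1) := by
  rw [KOV_encode_eq] at ha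
  simp only [List.mem_cons, List.mem_flatMap] at ha
  rcases ha with rfl | rfl | ⟨l, -, i, -, hi⟩
  · exact le_max_left _ _
  · exact le_max_of_le_right (le_max_left _ _)
  · exact le_max_of_le_right (le_max_of_le_right (le_one_of_mem_encodeBoolVec _ hi))

/-- **The input width of a `kOV k` input** with `k, N, d ≥ 1` is `Nat.size (2 + k N d)`: the length
dominates every word. [folklore] -/
theorem inputWidth_KOV_encode {k : ℕ} {I : KOVInstance k} (hk : 1 ≤ k) (hn : 1 ≤ I.n) (hd : 1 ≤ I.d) :
    inputWidth (KOVInstance.encode I) = Nat.size (2 + k * (I.n * I.d)) := by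
  unfold inputWidth
  rw [length_KOV_encode]
  congr 1
  have hnd : I.n * I.d ≤ k * (I.n * I.d) := Nat.le_mul_of_pos_left _ hk
  have hn' : I.n ≤ I.n * I.d := Nat.le_mul_of_pos_right _ hd
  have hd' : I.d ≤ I.n * I.d := Nat.le_mul_of_pos_left _ hn
  refine le_antisymm (max_le le_rfl (foldr_max_one_le (by omega) fun v hv => ?_)) (le_max_left _ _)
  refine (le_of_mem_KOV_encode I hv).trans (max_le (by omega) (max_le (by omega) (by omega)))

namespace KOVRed

/-! ### The split-and-list instance as an input of `kOVWithDim k c` -/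

/-- The size of `splitInst φ k c` is `N = 2^g`. [folklore] -/
theorem kOVWithDim_size_splitInst (φ : CNF ℕ) (k c : ℕ) :
    (kOVWithDim k c).size (splitInst φ k c) = 2 ^ glen φ.numVars k := rfl

/-- The encoding of `splitInst φ k c` is the `kOV k` encoding of `splitKOV φ k c`. [folklore] -/
theorem kOVWithDim_encode_splitInst (φ : CNF ℕ) (k c : ℕ) :
    (kOVWithDim k c).encode (splitInst φ k c) = KOVInstance.encode (splitKOV φ k c) := rfl

/-- The width of `splitInst φ k c` (`k, c ≥ 1`): `Nat.size (2 + k N d)`. [folklore] -/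
theorem kOVWithDim_width_splitInst (φ : CNF ℕ) {k c : ℕ} (hk : 1 ≤ k) (hc : 1 ≤ c) :
    (kOVWithDim k c).width (splitInst φ k c) =
      Nat.size (2 + k * (2 ^ glen φ.numVars k * (c * glen φ.numVars k))) := by
  show inputWidth (KOVInstance.encode (splitKOV φ k c)) = _
  rw [inputWidth_KOV_encode hk Nat.one_le_two_pow
    (Nat.le_mul_of_pos_right _ (one_le_glen _ _) |>.trans' hc)]
  rfl

open scoped Classical in
/-- **The accepted output on the instance** (`0 < k`, `m ≤ c g`): `[1]` if `φ` is satisfiable,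
`[0]` otherwise. [folklore] -/
theorem kOVWithDim_good_splitInst {φ : CNF ℕ} {k c : ℕ} (hk : 0 < k)
    (hm : φ.length ≤ c * glen φ.numVars k) :
    (kOVWithDim k c).Good (splitInst φ k c) = {[if φ.Satisfiable then 1 else 0]} := by
  show (kOV k).Good (splitKOV φ k c) = _
  by_cases h : φ.Satisfiable
  · rw [if_pos h]
    exact FGProblem.ofPred_good_of_pos _ _ _ _ ((hasOrthogonalTuple_splitKOV_iff hk hm).2 h)
  · rw [if_neg h]
    exact FGProblem.ofPred_good_of_neg _ _ _ _ (mt (hasOrthogonalTuple_splitKOV_iff hk hm).1 h)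

/-! ### The instances of `kSATProblem k'`

(The accepted output `[1]`/`[0]` is `OVRed.kSATProblem_good_iff` of `…OVFromSETHSplitInstance`.) -/

/-- The size of an instance of `kSATProblem k'` is `numVars`. [folklore] -/
theorem kSATProblem_size (k' : ℕ) (φ : (kSATProblem k').Inst) :
    (kSATProblem k').size φ = (φ.1 : CNF ℕ).numVars := rfl

/-- The encoding of an instance of `kSATProblem k'` is `encodeCNFWords`. [folklore] -/
theorem kSATProblem_encode (k' : ℕ) (φ : (kSATProblem k').Inst) :
    (kSATProblem k').encode φ = encodeCNFWords φ.1 := rfl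

/-- The width of an instance of `kSATProblem k'` is the input width of its encoding. [folklore] -/
theorem kSATProblem_width (k' : ℕ) (φ : (kSATProblem k').Inst) :
    (kSATProblem k').width φ = inputWidth (encodeCNFWords φ.1) := rfl

end KOVRed

end Literature.Computability.FineGrained
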